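import Summits.Ventures.QEC.CircuitDistance.SchedLeafDefsBB144o345
import Summits.Ventures.QEC.CircuitDistance.FibreLeaves345X9_04
import Summits.Ventures.QEC.CircuitDistance.PortLeafWFFast
import HarnessLib

/-!
# Q4 #345 (`sched345`, our numbering of the 936 orders): X-sector leaf ENTRIES weight-9 budget-1 word 3 and their kernel checks
# (cell `qec`, experiment CDX; seat qec-cdx-eng-1 g2 on type-2 g0's `SchedLeafDefsBB144o345`)

Per orbit representative (eng-1's word data + kernel UNSAT / null-split facts in `Fibre345X10.*` / `Fibre345X9.*`): the `LeafEntry`, `Leaf.wf`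
(b = 0: `decide`; b = 1: via `Leaf.wfFast`) and the base-column coverage check `o345XTable.covers₂ bb144SM 10` by `decide +kernel`, packed into
`LeafOK345X` by `xentry345_ok_of` — literally the `[[144]]` entry files (`PortBB144LeavesX` / `PortBB144LeavesZ8w*`, type-1) with `9 ↦ 10`,
`bb144XTable ↦ o345XTable`, `xentry144_ok_of ↦ xentry345_ok_of` (type-2 g0 2026-08-29T01:59:22Z). No `native_decide`; nothing here asserts a value of `d_circ` by itself.
-/

namespace Summit.Ventures.QEC.CircuitDistance

open Literature.InformationTheory.QuantumCodes

/-- Leaf entry of `X`-word 3 of order #345, weight 9, budget 1 (eng-1's `Fibre345X9.w003_*`: `N₀ = 10`, `w = 10`). -/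
def e345X9_3 : LeafEntry 12 6 :=
  ⟨wordOf144 Fibre345X9.w003_word, ⟨894, Fibre345X9.w003_coords, Fibre345X9.w003_groups, Fibre345X9.w003_nulls, Fibre345X9.w003_rows, Fibre345X9.w003_us, 10⟩⟩

set_option maxRecDepth 100000 in
set_option maxHeartbeats 4000000000 in
/-- KERNEL: the leaf passes the fast well-formedness check `wfFast` (PortLeafWFFast). -/
theorem e345X9_3_wfF : e345X9_3.leaf.wfFast = true := by decide +kernel

/-- The leaf is well-formed. -/
theorem e345X9_3_wf : e345X9_3.leaf.wf = true := Fibre.Leaf.wf_of_wfFast _ e345X9_3_wfF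

set_option maxRecDepth 100000 in
set_option maxHeartbeats 4000000000 in
/-- KERNEL: the leaf COVERS its word (base-column check `covers₂`, window 10, null columns included). -/
theorem e345X9_3_cov : o345XTable.covers₂ bb144SM 10 e345X9_3 = true := by decide +kernel

/-- The entry satisfies the hypotheses of the sector theorem (UNREALISED from eng-1's whole-word decider certificate `Fibre345X9.w003_not_realised`). -/
theorem e345X9_3_ok : LeafOK345X e345X9_3 :=
  xentry345_ok_of e345X9_3_wf e345X9_3_cov (by decide) rfl (by decide) Fibre345X9.w003_not_realised


end Summit.Ventures.QEC.CircuitDistance
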